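import Literature.Computability.Complexity.TVSelfCorrectApprox
import Literature.Computability.Complexity.UniformDerandomizationTester
import HarnessLib

/-!
# Self-correction of Trevisan–Vadhan's `F`: decoding the trials from coin BITS, and the failure
# probability over uniform coins

Literature / complexity — derandomization (Case 2 of IW98 in TV07 form), the probability form of the
random self-reduction of `F` (`TVSelfCorrectApprox.card_majCorrected_ne_le_div_of_mem_approx` counts
tuples of TRIALS; a strong construction (IW98 Def. 4) draws uniform BITS). The `s = trialsOf (2a)` trials
of `linesOf n` lines are read off a bit string block by block — trial `t` occupies
`trialLen n i = padLen n i + linesOf n · ptLen n` bits: its pad, then its lines, each line `N n` field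
elements of `blk n` bits decoded in the power basis (`decF`) — and this decoding is a BIJECTION from
`{0,1}^{s · trialLen}` onto the trial tuples, so uniform bits give uniform trials:

* `QBFUniv.trialLen`, `QBFUniv.coinsLen n i a = trialsOf (2a) · trialLen n i`, **`QBFUniv.decodeTrials`**
  (explicit index formulas: `decodeTrials_fst`, `decodeTrials_snd`; `decodeTrials_take`);
* `QBFUniv.decodeTrials_injective`, `QBFUniv.card_trials_eq`, **`QBFUniv.decodeEquiv`** (the bijection),
  **`QBFUniv.uniformProb_decodeTrials`** (`Pr_u[P (decodeTrials u)] = #{cs | P cs} / #tuples`);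
* **`QBFUniv.uniformProb_majCorrected_ne_le`** — for `d ∈ approxCircuits Ev FB ρ (h n i)` with
  `ρ (h n i) ≤ 1/(64 · blk n · (Dn n + 1)²)` and `a ≥ 1`: over uniform coins of any length `≥ coinsLen n i a`
  the corrected majority of `descFn Ev d` (trials decoded from the coins) differs from `F` somewhere on
  `{0,1}^{h n i}` with probability `≤ 1/(2a)`.

Everything is proved; definitions are plain (no named facts).

## References

* [ImpagliazzoWigderson2001] R. Impagliazzo, A. Wigderson, JCSS 63 (2001), §2.2 Defs. 4–5.
* [TrevisanVadhan2007] L. Trevisan, S. Vadhan, Comput. Complexity 16 (2007), Lemma 3.5, Thm. 4.3 (proof).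
* [AroraBarakCC2009] S. Arora, B. Barak, CUP 2009, §7.4.1 (independent coin blocks).
-/

noncomputable section

namespace Literature.Computability.Complexity

namespace QBFUniv

open Finset Literature.InformationTheory.Coding PolySelfCorrect IWUniform

open scoped Classical

variable {n i : ℕ}

/-! ### The layout of the coins -/

/-- Bits of one trial: its pad, then `linesOf n` lines of `ptLen n = N n · blk n` bits. [folklore] -/
def trialLen (n i : ℕ) : ℕ := padLen n i + linesOf n * ptLen n

/-- **The coins of the corrected majority** for success `1 − 1/(2a)`: `trialsOf (2a)` trials. [folklore] -/
def coinsLen (n i a : ℕ) : ℕ := trialsOf (2 * a) * trialLen n i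

/-- **Decoding the trials** from a bit string: trial `t` reads its pad at offset `t · trialLen`, and the
`v`-th coordinate of its `j`-th line as the field element with power-basis bits at offset
`t · trialLen + padLen + j · ptLen + v · blk`. [cite: TrevisanVadhan2007, Lemma 3.5] -/
def decodeTrials (n i s : ℕ) (u : List Bool) : Fin s → Trial n i (linesOf n) := fun t =>
  (fun j => u.getD (t.val * trialLen n i + j.val) false,
    fun j v => decF (Mof n) fun l => u.getD (t.val * trialLen n i + padLen n i + j.val * ptLen n + v.val * blk n + l.val) false)

/-- The pad bits of a decoded trial. [folklore] -/
@[simp] theorem decodeTrials_fst (n i s : ℕ) (u : List Bool) (t : Fin s) (j : Fin (padLen n i)) :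
    (decodeTrials n i s u t).1 j = u.getD (t.val * trialLen n i + j.val) false := rfl

/-- The line coordinates of a decoded trial. [folklore] -/
@[simp] theorem decodeTrials_snd (n i s : ℕ) (u : List Bool) (t : Fin s) (j : Fin (linesOf n)) (v : Fin (N n)) :
    (decodeTrials n i s u t).2 j v =
      decF (Mof n) fun l => u.getD (t.val * trialLen n i + padLen n i + j.val * ptLen n + v.val * blk n + l.val) false := rfl

/-- A position inside the line area of a trial. [folklore] -/
theorem lineIndex_lt {n : ℕ} (j : Fin (linesOf n)) (v : Fin (N n)) (l : Fin (blk n)) :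
    j.val * ptLen n + v.val * blk n + l.val < linesOf n * ptLen n := by
  have hv : v.val * blk n + l.val < ptLen n := by
    rw [ptLen]
    calc v.val * blk n + l.val < v.val * blk n + blk n := by have := l.isLt; omega
      _ = (v.val + 1) * blk n := by ring
      _ ≤ N n * blk n := Nat.mul_le_mul_right _ v.isLt
  calc j.val * ptLen n + v.val * blk n + l.val < j.val * ptLen n + ptLen n := by omega
    _ = (j.val + 1) * ptLen n := by ring
    _ ≤ linesOf n * ptLen n := Nat.mul_le_mul_right _ j.isLt

/-- A position of a trial is within the coins. [folklore] -/
theorem trialIndex_lt {n i s : ℕ} (t : Fin s) {e : ℕ} (he : e < trialLen n i) : t.val * trialLen n i + e < s * trialLen n i := by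
  calc t.val * trialLen n i + e < t.val * trialLen n i + trialLen n i := by omega
    _ = (t.val + 1) * trialLen n i := by ring
    _ ≤ s * trialLen n i := Nat.mul_le_mul_right _ t.isLt

/-- **The decoding reads only the first `s · trialLen` bits.** [folklore] -/
theorem decodeTrials_take (n i s : ℕ) (u : List Bool) :
    decodeTrials n i s (u.take (s * trialLen n i)) = decodeTrials n i s u := by
  funext t
  refine Prod.ext (funext fun j => ?_) (funext fun j => funext fun v => ?_)
  · simp only [decodeTrials_fst]
    rw [List.getD_eq_getElem?_getD, List.getD_eq_getElem?_getD, List.getElem?_take_of_lt]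
    exact trialIndex_lt t (by rw [trialLen]; have := j.isLt; omega)
  · simp only [decodeTrials_snd]
    congr 1; funext l
    rw [List.getD_eq_getElem?_getD, List.getD_eq_getElem?_getD, List.getElem?_take_of_lt]
    have eidx : t.val * trialLen n i + padLen n i + j.val * ptLen n + v.val * blk n + l.val =
        t.val * trialLen n i + (padLen n i + (j.val * ptLen n + v.val * blk n + l.val)) := by ring
    rw [eidx]
    exact trialIndex_lt t (by rw [trialLen]; have := lineIndex_lt j v l; omega)

/-! ### The decoding is a bijection -/

/-- **Every coin position is read**: position `m < s · trialLen` is a pad bit or a line bit of a definite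
trial. [folklore] -/
theorem exists_index (n i s : ℕ) {m : ℕ} (hm : m < s * trialLen n i) :
    ∃ t : Fin s, (∃ j : Fin (padLen n i), m = t.val * trialLen n i + j.val) ∨
      ∃ (j : Fin (linesOf n)) (v : Fin (N n)) (l : Fin (blk n)),
        m = t.val * trialLen n i + padLen n i + j.val * ptLen n + v.val * blk n + l.val := by
  have hTdef : trialLen n i = padLen n i + linesOf n * ptLen n := rfl
  have hT : 0 < trialLen n i := Nat.pos_of_ne_zero fun h0 => by rw [h0, Nat.mul_zero] at hm; exact Nat.not_lt_zero _ hm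
  refine ⟨⟨m / trialLen n i, (Nat.div_lt_iff_lt_mul hT).2 hm⟩, ?_⟩
  have hme : m / trialLen n i * trialLen n i + m % trialLen n i = m := Nat.div_add_mod' _ _
  have helt : m % trialLen n i < trialLen n i := Nat.mod_lt _ hT
  by_cases hp : m % trialLen n i < padLen n i
  · exact Or.inl ⟨⟨m % trialLen n i, hp⟩, hme.symm⟩
  · right
    have he'lt : m % trialLen n i - padLen n i < linesOf n * ptLen n := by omega
    have hL : 0 < ptLen n := Nat.pos_of_ne_zero fun h0 => by rw [h0, Nat.mul_zero] at he'lt; exact Nat.not_lt_zero _ he'lt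
    have hb : 0 < blk n := blk_pos n
    have hPdef : ptLen n = N n * blk n := rfl
    have hmod : (m % trialLen n i - padLen n i) % ptLen n < ptLen n := Nat.mod_lt _ hL
    refine ⟨⟨(m % trialLen n i - padLen n i) / ptLen n, (Nat.div_lt_iff_lt_mul hL).2 he'lt⟩,
      ⟨(m % trialLen n i - padLen n i) % ptLen n / blk n, (Nat.div_lt_iff_lt_mul hb).2 (by rw [← hPdef]; exact hmod)⟩,
      ⟨(m % trialLen n i - padLen n i) % ptLen n % blk n, Nat.mod_lt _ hb⟩, ?_⟩
    have h1 : (m % trialLen n i - padLen n i) / ptLen n * ptLen n + (m % trialLen n i - padLen n i) % ptLen n =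
        m % trialLen n i - padLen n i := Nat.div_add_mod' _ _
    have h2 : (m % trialLen n i - padLen n i) % ptLen n / blk n * blk n + (m % trialLen n i - padLen n i) % ptLen n % blk n =
        (m % trialLen n i - padLen n i) % ptLen n := Nat.div_add_mod' _ _
    simp only
    omega

/-- Reading a listed bit vector. [folklore] -/
theorem getD_ofFn_fin {L : ℕ} (w : Fin L → Bool) {k : ℕ} (hk : k < L) : (List.ofFn w).getD k false = w ⟨k, hk⟩ := by
  rw [List.getD_eq_getElem _ _ (by simpa using hk), List.getElem_ofFn]

/-- **The decoding is injective** on bit vectors of the exact length. [folklore] -/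
theorem decodeTrials_injective (n i s : ℕ) :
    Function.Injective fun u : Fin (s * trialLen n i) → Bool => decodeTrials n i s (List.ofFn u) := by
  intro u u' huu
  funext m
  obtain ⟨t, ⟨j, hm⟩ | ⟨j, v, l, hm⟩⟩ := exists_index n i s m.isLt
  · have key := congrArg (fun cs : Fin s → Trial n i (linesOf n) => (cs t).1 j) huu
    simp only [decodeTrials_fst] at key
    have hlt : t.val * trialLen n i + j.val < s * trialLen n i := hm ▸ m.isLt
    rw [getD_ofFn_fin u hlt, getD_ofFn_fin u' hlt] at key
    have e : m = ⟨_, hlt⟩ := Fin.ext hm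
    rw [e]; exact key
  · have key := congrArg (fun cs : Fin s → Trial n i (linesOf n) => encF (Mof n) ((cs t).2 j v) l) huu
    simp only [decodeTrials_snd, encF_decF] at key
    have hlt : t.val * trialLen n i + padLen n i + j.val * ptLen n + v.val * blk n + l.val < s * trialLen n i := hm ▸ m.isLt
    rw [getD_ofFn_fin u hlt, getD_ofFn_fin u' hlt] at key
    have e : m = ⟨_, hlt⟩ := Fin.ext hm
    rw [e]; exact key

/-- The number of trials of one round, in `ℕ`. [folklore] -/
theorem card_Trial_nat (n i r : ℕ) : Fintype.card (Trial n i r) = 2 ^ (padLen n i + r * ptLen n) := by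
  simp only [Fintype.card_prod, Fintype.card_fun, Fintype.card_bool, Fintype.card_fin]
  rw [card_K_pow, ← pow_mul, ← pow_add, Nat.mul_comm]

/-- **The number of trial tuples is the number of coin strings.** [folklore] -/
theorem card_trials_eq (n i s : ℕ) : Fintype.card (Fin s → Trial n i (linesOf n)) = 2 ^ (s * trialLen n i) := by
  rw [Fintype.card_fun, Fintype.card_fin, card_Trial_nat, ← pow_mul, trialLen, Nat.mul_comm]

/-- **The decoding bijection** `{0,1}^{s · trialLen} ≃ (trial tuples)`. [folklore] -/
def decodeEquiv (n i s : ℕ) : (Fin (s * trialLen n i) → Bool) ≃ (Fin s → Trial n i (linesOf n)) :=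
  Equiv.ofBijective _ ((Fintype.bijective_iff_injective_and_card _).2
    ⟨decodeTrials_injective n i s, by rw [Fintype.card_fun, Fintype.card_bool, Fintype.card_fin, card_trials_eq]⟩)

/-- Value of the decoding bijection. [folklore] -/
@[simp] theorem decodeEquiv_apply (n i s : ℕ) (u : Fin (s * trialLen n i) → Bool) :
    decodeEquiv n i s u = decodeTrials n i s (List.ofFn u) := rfl

/-- **Uniform bits give uniform trials**: the probability of a property of the decoded trials is its
counting frequency among the tuples. [cite: AroraBarakCC2009, §7.4.1] -/
theorem uniformProb_decodeTrials (n i s : ℕ) (P : (Fin s → Trial n i (linesOf n)) → Prop) :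
    uniformProb (s * trialLen n i) {u | P (decodeTrials n i s u)} =
      (#(univ.filter P) : ℝ) / Fintype.card (Fin s → Trial n i (linesOf n)) := by
  rw [uniformProb_eq_card_filter_ofFn (s * trialLen n i) (inst := fun _ => Classical.propDecidable _), card_trials_eq]
  push_cast
  congr 1
  exact_mod_cast Finset.card_equiv (decodeEquiv n i s) fun v => by simp

/-! ### The failure probability of the corrected majority over uniform coins -/

/-- **Over uniform coins, the corrected majority of an approximate description fails with probability
`≤ 1/(2a)`.** [cite: ImpagliazzoWigderson2001, Defs. 4–5] [cite: TrevisanVadhan2007, Lemma 3.5] -/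
theorem uniformProb_majCorrected_ne_le (hi : i ≤ mlen n) {Ev : List Bool → List Bool} {d : List Bool} {ρ : ℕ → ℝ}
    (hd : d ∈ approxCircuits Ev FB ρ (h n i)) (hρ : ρ (h n i) ≤ 1 / ((64 * blk n * (Dn n + 1) ^ 2 : ℕ) : ℝ))
    {a : ℕ} (ha : 1 ≤ a) {L : ℕ} (hL : coinsLen n i a ≤ L) :
    uniformProb L {u | ∃ w : List Bool, w.length = h n i ∧
        majCorrected (descFn Ev d) n (decodeTrials n i (trialsOf (2 * a)) u) w ≠ FB w} ≤ 1 / (2 * a : ℝ) := by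
  -- the event depends only on the first `coinsLen` bits
  have hE : {u : List Bool | ∃ w : List Bool, w.length = h n i ∧
        majCorrected (descFn Ev d) n (decodeTrials n i (trialsOf (2 * a)) u) w ≠ FB w} =
      {u | u.take (trialsOf (2 * a) * trialLen n i) ∈ {u : List Bool | ∃ w : List Bool, w.length = h n i ∧
        majCorrected (descFn Ev d) n (decodeTrials n i (trialsOf (2 * a)) u) w ≠ FB w}} := by
    ext u; simp only [Set.mem_setOf_eq, decodeTrials_take]
  obtain ⟨e, rfl⟩ := Nat.exists_eq_add_of_le hL
  have h2 := uniformProb_decodeTrials n i (trialsOf (2 * a))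
    (fun cs => ∃ w : List Bool, w.length = h n i ∧ majCorrected (descFn Ev d) n cs w ≠ FB w)
  rw [hE, coinsLen, uniformProb_take_event, h2]
  have h1 := card_majCorrected_ne_le_div_of_mem_approx hi hd hρ (a := 2 * a) (by omega)
  have hpos : (0 : ℝ) < Fintype.card (Fin (trialsOf (2 * a)) → Trial n i (linesOf n)) := by exact_mod_cast Fintype.card_pos
  rw [div_le_iff₀ hpos]
  push_cast at h1
  calc (#(univ.filter fun cs : Fin (trialsOf (2 * a)) → Trial n i (linesOf n) =>
        ∃ w : List Bool, w.length = h n i ∧ majCorrected (descFn Ev d) n cs w ≠ FB w) : ℝ)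
      ≤ Fintype.card (Fin (trialsOf (2 * a)) → Trial n i (linesOf n)) / (2 * a : ℝ) := h1
    _ = 1 / (2 * a : ℝ) * Fintype.card (Fin (trialsOf (2 * a)) → Trial n i (linesOf n)) := by ring

end QBFUniv

end Literature.Computability.Complexity

end
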